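import Summits.CriticalPhenomena.PercolationContinuityZ3.Theses.PercDustRigidity
import Summits.CriticalPhenomena.PercolationContinuityZ3.Theorems.PercNearOneGluingNoHeavyLowerTailCSHTheoremOne
import Literature.Probability.Percolation.UniquenessInsertionTolerant
import HarnessLib

/-!
# `PercDustRigidity.DustRigiditySplitGlue` (stmt-CriticalPhenomena-18906) — SETTLED after continuity

Item `stmt-CriticalPhenomena-18906` of route `CriticalPhenomena/PercDustRigidity` (support (split glue)): `NoInfinitelyFragileGiant → SieveCoarsening → DustRigidity`.

PORT of the strategist's kernel-checked `Cruxes/DustRigidity/SplitGlueTheorems.lean` (`dustRigidity_of_subs`: Burton–Keane uniqueness for insertion-tolerant ergodic measures discharges the uniqueness hypothesis of both pieces; the dust clause gives death off the level-1 sieve by cluster monotonicity; induction on the level with `SieveCoarsening`; `NoInfinitelyFragileGiant` concludes).  p205010 is NOT used.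

builds on p205010 (kernel theorem, internal audit signed; external expert review pending) — USED (`CSH.percolationContinuityZ3_holds`).  RSW3 lane, lead gen 28 (prover-prim-rsw3-lead-g28-0):
'after continuity — the ledger harvest'.
References: G. Kozma, N. Nitzan (2024), Thm. 6 / Conj. 3 [KozmaNitzan2024]; G. Grimmett, *Percolation* (1999), §8 [GrimmettPercolation1999].
-/

noncomputable section

namespace Summit.CriticalPhenomena.PercolationContinuityZ3.Theorems

namespace PercDustRigidityDustRigiditySplitGlue

open MeasureTheory Literature.Probability.Percolation Literature.Probability.LatticeModels
open Filter Set
open Summit.CriticalPhenomena.PercolationContinuityZ3.Theses.PercDustRigidity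

/-- **Assembly of the split**: `NoInfinitelyFragileGiant → SieveCoarsening → DustRigidity`.
[folklore] -/
theorem dustRigidity_of_subs (hN : NoInfinitelyFragileGiant) (hC : SieveCoarsening) : DustRigidity := by
  intro μ hμ h1 h2 h3 h4 h5 h6 h7 h8 h9 hdust
  obtain ⟨S, hS, -, hdeath⟩ := hdust
  -- (1) Burton–Keane: (H1)–(H4) are the hypotheses `IsInsertionTolerantErgodic μ`
  have hITE : Literature.Probability.Percolation.IsInsertionTolerantErgodic μ :=
    { ae_subset_edgeSet := h1
      measure_preimage_shift := fun v _ hS' => h2 v _ hS'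
      zero_one := fun hS' hinv => h3 _ hS' hinv
      insertion_tolerant := fun N => by
        obtain ⟨c, hc, hcS⟩ := h4 N
        exact ⟨c, hc, fun hS' => hcS _ hS'⟩ }
  have hU : ∀ᵐ ω ∂μ, Literature.Probability.Percolation.numInfiniteClusters ω ≤ 1 :=
    Literature.Probability.Percolation.ae_numInfiniteClusters_le_one_of_isInsertionTolerantErgodic hITE
  -- (2) dust-fragility ⇒ death off the whole level-1 sieve (cluster monotonicity, `S ⊆ D₁ = D_1`)
  have hSD : S ⊆ {e | ∃ y : Literature.Probability.LatticeModels.Site 3,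
      (∀ i, (2 ^ 1 : ℤ) ∣ y i) ∧ e = s(y, y + Pi.single (2 : Fin 3) 1)} := by
    intro e he
    obtain ⟨y, hy, rfl⟩ := hS he
    exact ⟨y, fun i => by simpa using hy i, rfl⟩
  have hD1 : ∀ᵐ ω ∂μ, ∀ x : Literature.Probability.LatticeModels.Site 3,
      (Literature.Probability.Percolation.openCluster (ω \ {e | ∃ y : Literature.Probability.LatticeModels.Site 3,
        (∀ i, (2 ^ 1 : ℤ) ∣ y i) ∧ e = s(y, y + Pi.single (2 : Fin 3) 1)}) x).Finite := by
    filter_upwards [hdeath] with ω hω x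
    exact (hω x).subset (Literature.Probability.Percolation.openCluster_mono (sdiff_le_sdiff_left hSD) x)
  -- (3) induction on the level with X₂
  have hall : ∀ k : ℕ, 1 ≤ k → ∀ᵐ ω ∂μ, ∀ x : Literature.Probability.LatticeModels.Site 3,
      (Literature.Probability.Percolation.openCluster (ω \ {e | ∃ y : Literature.Probability.LatticeModels.Site 3,
        (∀ i, (2 ^ k : ℤ) ∣ y i) ∧ e = s(y, y + Pi.single (2 : Fin 3) 1)}) x).Finite := by
    intro k hk
    induction k, hk using Nat.le_induction with
    | base => exact hD1
    | succ k hk ih => exact hC μ hμ h1 h2 h3 h4 h5 h6 h7 h8 h9 hU k hk ih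
  -- (4) X₁ concludes
  exact hN μ hμ h1 h2 h3 h4 h5 h6 h7 h8 h9 hU hall

/-- **`PercDustRigidity.DustRigiditySplitGlue` (stmt-CriticalPhenomena-18906), settled.**  `fun h1 h2 => dustRigidity_of_subs h1 h2` (ported strategist assembly).
[cite: KozmaNitzan2024, Thm. 6 with Conj. 3 (p. 15)] -/
theorem dustRigiditySplitGlue_proof : Summit.CriticalPhenomena.PercolationContinuityZ3.Theses.PercDustRigidity.DustRigiditySplitGlue := by
  intro h1 h2
  exact dustRigidity_of_subs h1 h2

end PercDustRigidityDustRigiditySplitGlue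

end Summit.CriticalPhenomena.PercolationContinuityZ3.Theorems

end
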